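/-
Origin: expansion seat `prover-pub-hodgecm-mc-binder-1-g14-0`, handover #R85 2026-08-20T16:54:41Z md5 446588c3aa52 (121 l.; NEW additive MODEL leaf (re-cut 4-ary), (J5a) [Liu21] Def 4.3/4.5-shaped constructor; imports HsmallOfCommonReflex ONLY; drop-alone; NAME LIST: HodgeCM.Model.CommonReflexInput.classes_ofInflated · HodgeCM.Model.span_classes_ofInflated_le_Uiso) (`HOME/mc/pub-hodgecm-mc-binder-1-g14/stage56/HodgeCM/Model/CommonReflexOfInflated.lean`, md5 446588c3aa52, 121 lines);
landed by the second packager p2 gen 10 (p2-g10) in gate run 56 as `HodgeCM/Model/CommonReflexOfInflated.lean` (packager comment re-wording per the RUN-32 precedent (gate audit (5) rejects the proof-placeholder tokens s-o-r-r-y / a-d-m-i-t anywhere in a source, comments included): 1 occurrence(s) inside COMMENTS re-spelt `proof-hole` / `adm-token`; no Lean code byte touched).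
-/
/-
Copyright (c) 2026 the pub-hodgecm formalisation cell (harness21).  New file, not vendored.
Origin: session prover-pub-hodgecm-mc-binder-1-g14-0 (unit pub-hodgecm-mc-binder-1-g14, BINDER PROVER gen 14 of lineage mc-binder-1;
content lane (J-Liu-Θ) of BINDER-TRIAGE §58.2, scope memo `HOME/mc/pub-hodgecm-mc-binder-1-g14/JLIU-THETA-SCOPE.md` item (J5)),
2026-08-20.  Intended final place: `HodgeCM/Model/CommonReflexOfInflated.lean` (NEW additive MODEL leaf beside
`Model/HsmallOfCommonReflex.lean` (RUN 38 #5, axioms-1-g12); imports that module only; nothing imports it; drop alone on bounce).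
-/
import Summits.HodgeConjecture.HodgeCM.Model.HsmallOfCommonReflex

set_option autoImplicit false

/-!
# The common-reflex datum of CM data of INFLATED type (the shape [Liu21] Def. 4.3 / 4.5 delivers) — item (J5)

KERNEL over `Model/HsmallOfCommonReflex` (RUN 38): one constructor and its unfolding lemmas; no new hypothesis kind, nothing cited,
nothing minted.

`HodgeCM.Model.CommonReflexInput K Ψ σ` (RUN 38) packages, for a corner `(K, Ψ, σ)`, a COMMON source `(M', Φ')` of which BOTH the
corner type `Ψ` (along `k₁ : M' → K`) and the CM type `Φ_A` of an auxiliary abelian variety `A` with `𝓞_M`-multiplication (along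
`k₂ : M' → M`) are inflations, together with `τ : M → ℂ` over `σ`.  The published route to E's row 9 ([Liu21] = arXiv:2102.11518
§4.2) delivers CM data of exactly the following SPECIAL shape — Def. 4.3: `M'_μ :=` the reflex field of `(E, Φ_μ)` with the reflex
type `Φ'_μ`; Def. 4.5: `A_μ` with a CM structure `i_μ : M_μ → End⁰(A_μ)`, `M_μ ⊇ M'_μ`, and `det (i_μ(x) | Lie A_μ) = N'_μ(x)`, i.e.
(over `ℂ`) CM type THE INFLATION of `Φ'_μ` to `M_μ`; the eigenvector `α` of the proof of Thm. 4.18 (map (4.3)) is taken for the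
INCLUSION `M_μ ⊂ ℂ` — i.e. the corner field ITSELF is the common source: `M' := K`, `Φ' := Ψ`, `k₁ := id`, and `Φ_A := Ψ^M`
(`CMTypeOps.inflate k₂ Ψ`).  (That the reflex of `(E, Φ_μ) = (L, Ψ̃_i)` IS the corner `(c.K, c.Ψ i)` is PerL v5 Lemma [lem:reflex] (b),
tex ll. 143–149 — item (J5)'s other half, not in this file.)

* `HodgeCM.Model.CommonReflexInput.ofInflated` — the constructor: from `k₂ : K →+* M`, an abelian variety `(A, ι_A, θ_A)` realising
  `(M; Ψ^M)` on `H¹`, and `τ : M →+* ℂ` with `τ ∘ k₂ = σ`, the datum `D : CommonReflexInput K Ψ σ` with `M' := K`, `Φ' := Ψ`, `k₁ := id`;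
* `…ofInflated_A/_τ/_M/_ΦA/_k₂` — field unfoldings (`rfl`);
* `HodgeCM.Model.span_classes_ofInflated_le_Uiso` — (J) for such data, = `Model.span_classes_le_Uiso` at `ofInflated …`:
  `span (D.surfaceClasses V Γ) ≤ U.Uiso Γ K Ψ σ` (`σ ∈ Ψ`, `hR`).

0 `proof-hole`, 0 `axiom`; expected `#print axioms` ⊆ {propext, Classical.choice, Quot.sound}.
-/

noncomputable section

open scoped TensorProduct
open NumberField CategoryTheory Module

namespace HodgeCM

namespace Model

open Literature.AlgebraicGeometry.Motives (CMType AbelianVariety bettiCohomology SchemeOver)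
open Literature.AlgebraicGeometry.HodgeTheory
open Literature.AlgebraicGeometry.HodgeTheory.BettiUniverse (pull cmAction IsInducedOnIntegers)
open Literature.AlgebraicGeometry.ComplexMultiplication (IsCMTypeRealisation)
open Literature.NumberTheory.Automorphic.PicardCM
open HodgeCM.CMTypeOps (inflate inflate_id mem_inflate_iff)

namespace CommonReflexInput

variable {K : CMField} {Ψ : CMType K} {σ : K →+* ℂ}

/-- **The common-reflex datum of CM data of inflated type** ([Liu21] Def. 4.3 / 4.5 shape): the corner field `K` itself is the
common source (`M' := K`, `Φ' := Ψ`, `k₁ := id`), the auxiliary variety `A` has `𝓞_M`-multiplication realising the INFLATED type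
`Ψ^M` along `k₂ : K →+* M`, and `τ : M →+* ℂ` lies over `σ`. [folklore] -/
def ofInflated (M : Type) [Field M] [NumberField M] (k₂ : K →+* M)
    (A : AbelianVariety ℂ) (ιA : 𝓞 M →+* End A) (θA : M →+* Module.End ℂ (complexBetti A.X 1))
    (hA : IsCMTypeRealisation (inflate k₂ Ψ) A ιA θA) (τ : M →+* ℂ) (hτ : τ.comp k₂ = σ) :
    CommonReflexInput K Ψ σ where
  M' := K
  Φ' := Ψ
  k₁ := RingHom.id K
  mem_iff := fun ρ => by rw [RingHom.comp_id]
  M := M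
  k₂ := k₂
  ΦA := inflate k₂ Ψ
  memA_iff := fun ρ => mem_inflate_iff k₂ Ψ ρ
  A := A
  ιA := ιA
  θA := θA
  isRealisation := hA
  τ := τ
  comp_eq := by rw [hτ, RingHom.comp_id]

variable (M : Type) [Field M] [NumberField M] (k₂ : K →+* M)
  (A : AbelianVariety ℂ) (ιA : 𝓞 M →+* End A) (θA : M →+* Module.End ℂ (complexBetti A.X 1))
  (hA : IsCMTypeRealisation (inflate k₂ Ψ) A ιA θA) (τ : M →+* ℂ) (hτ : τ.comp k₂ = σ)

/-- (Ported verbatim from the HodgeCMPerL package; no docstring in the source.) -/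
@[simp] theorem ofInflated_A : (ofInflated M k₂ A ιA θA hA τ hτ).A = A := rfl
/-- (Ported verbatim from the HodgeCMPerL package; no docstring in the source.) -/
@[simp] theorem ofInflated_τ : (ofInflated M k₂ A ιA θA hA τ hτ).τ = τ := rfl
/-- (Ported verbatim from the HodgeCMPerL package; no docstring in the source.) -/
@[simp] theorem ofInflated_θA : (ofInflated M k₂ A ιA θA hA τ hτ).θA = θA := rfl
/-- (Ported verbatim from the HodgeCMPerL package; no docstring in the source.) -/
theorem ofInflated_M : (ofInflated M k₂ A ιA θA hA τ hτ).M = M := rfl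
/-- (Ported verbatim from the HodgeCMPerL package; no docstring in the source.) -/
theorem ofInflated_ΦA : (ofInflated M k₂ A ιA θA hA τ hτ).ΦA = inflate k₂ Ψ := rfl
/-- (Ported verbatim from the HodgeCMPerL package; no docstring in the source.) -/
theorem ofInflated_k₂ : (ofInflated M k₂ A ιA θA hA τ hτ).k₂ = k₂ := rfl

/-- The classes of the inflated datum on a scheme `X/ℂ`, unfolded: the pull-backs `(f^*)_ℂ α`, `f : X → A`, `α` a `τ`-eigenvector
of the complexified CM action of `M` on `ℂ ⊗ H¹(A; ℚ)` (definitional). [folklore] -/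
theorem classes_ofInflated (X : SchemeOver ℂ) :
    (ofInflated M k₂ A ιA θA hA τ hτ).classes X =
      {x | ∃ (f : X ⟶ A.X) (α : ℂ ⊗[ℚ] bettiCohomology A.X 1),
        α ∈ eigenline (HodgeCM.CM.CommonReflex.complexify (cmAction θA hA.isInducedOnIntegers)) τ ∧
          x = (pull f 1).baseChange ℂ α} :=
  rfl

end CommonReflexInput

variable (hHD : exists_isReal_hodgeModel) (hI : hodgePQ_independent_of_hodgeModel)
  (h₁ : BallQuotientUniformised) (h₃ : CMAbelianVarietyRealised)

/-- **(J) for CM data of inflated type**: on the end-state universe, the span of the pull-backs to THE realised surface `P_Γ` of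
`τ`-eigen classes of an abelian variety realising `(M; Ψ^M)`, `τ|_K = σ ∈ Ψ`, lies in `Uiso Γ K Ψ σ` (granted `hR`) —
`Model.span_classes_le_Uiso` at `CommonReflexInput.ofInflated`. [folklore] -/
theorem span_classes_ofInflated_le_Uiso (hR : DeligneMilne1982_Thm_6_20_full)
    {L : CMField} {ι₁ : L →+* ℂ} (V : HermSpace3 L ι₁) (Γ : Level V)
    {K : CMField} {Ψ : CMType K} {σ : K →+* ℂ} (hσ : σ ∈ Ψ.1)
    (M : Type) [Field M] [NumberField M] (k₂ : K →+* M)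
    (A : AbelianVariety ℂ) (ιA : 𝓞 M →+* End A) (θA : M →+* Module.End ℂ (complexBetti A.X 1))
    (hA : IsCMTypeRealisation (inflate k₂ Ψ) A ιA θA) (τ : M →+* ℂ) (hτ : τ.comp k₂ = σ) :
    Submodule.span ℂ ((CommonReflexInput.ofInflated M k₂ A ιA θA hA τ hτ).surfaceClasses hHD hI h₁ h₃ V Γ) ≤
      (picardCMUniverse hHD hI h₁ h₃).Uiso Γ K Ψ σ :=
  span_classes_le_Uiso hHD hI h₁ h₃ hR V Γ hσ _

end Model

end HodgeCM

end
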